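import Mathlib
import HarnessLib
import Literature.Analysis.FluidPDE.LocalTypeIPersistence
import Literature.Analysis.FluidPDE.CKNLocalRegularityRRSPressure

/-!
# Route `AxisTwistDoor`, crux `AveragedConeLiouville` (stmt-NavierStokesRegularity-26889) — toward replacing the
# Lei–Ren input (programme R2), piece S4: QUANTITATIVE PERSISTENCE OF REGULARITY (Rusin–Šverák / Albritton–Barker
# Prop. 2.3 with the radius and the centre made explicit)

The tree's `PersistenceOfSingularities_holds` (Albritton–Barker 2019, Prop. 2.3) says: if a sequence of suitable weak
solutions `(v_k, q_k)` on `Q(0,1)`, bounded in `L³ × L^{3/2}`, converges to `u` strongly in `L³`, and the `v_k` are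
unbounded on EVERY `Q(0, R)`, then `u` is backward-singular at the vertex.  Its contrapositive provides SOME radius of
eventual boundedness — too weak for the covering argument of programme R2 at interior points of the regular shell
(LEAD census CENSUS-26889-g2.md).  This file re-runs the tree's proof (`PersistenceOfSingularities_of_unforced`:
cubic quantities of the approximants by `cknC_le_of_ae_bound_of_lintegral_sub`, pressure by the iterated
Seregin–Šverák decay `cknD_iterate_le_of_pressure_decay`, then the quantitative one-scale criterion
`unforced_epsilonRegularity_of_theorem15_3` / `RRS2016.theorem15_3_holds`) at an ARBITRARY vertex `w′` with the radius
EXPLICIT and UNIFORM: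

* `quantitative_persistence` — given the data above, the strong `L³` convergence on a set `K ⊆ Q(0,1)`, a radius
  `r₁ > 0` and a level `M < ∞`, there are `s ∈ (0, r₁]` and `C ≥ 0` (depending on `M`, `r₁` and the uniform bound
  only) such that for all large `k` and EVERY vertex `w′` with `Q(w′, r₁) ⊆ K` and `|u| ≤ M` a.e. on `Q(w′, r₁)`:
  `‖v_k‖_{L^∞(Q(w′, s/2))} ≤ C/s`.

Seat ns-atd-p1 (LEAD g2).  WHAT THIS IS NOT: not a statement about Navier–Stokes regularity; a compactness tool
serving a STAGED door route.  Lands `--supports` the crux item as a helper.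
-/

noncomputable section

set_option linter.dupNamespace false

namespace Summit.NavierStokesRegularity.NavierStokesRegularity.Theorems.AveragedConeLiouville.QuantPersistence

open scoped ENNReal NNReal Topology
open Set Function MeasureTheory Metric Filter TopologicalSpace
open Literature.Analysis.FluidPDE

/-- **Quantitative persistence of regularity** (Albritton–Barker 2019, Prop. 2.3 / Rusin–Šverák 2011, Lemma 2.1, with
explicit uniform radius and arbitrary vertex).  [cite: AlbrittonBarker2019, Prop. 2.3 (proof, arXiv p. 5);
RusinSverak2011, Lemma 2.1] -/
theorem quantitative_persistence
    {v : ℕ → ℝ → EuclideanSpace ℝ (Fin 3) → EuclideanSpace ℝ (Fin 3)}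
    {q : ℕ → ℝ → EuclideanSpace ℝ (Fin 3) → ℝ}
    {u : ℝ → EuclideanSpace ℝ (Fin 3) → EuclideanSpace ℝ (Fin 3)}
    (hball : ∀ k, IsSuitableWeakSolutionInBall 1 0 (v k) (q k))
    (hsup : (⨆ k, (eLpNorm (uncurry (v k)) 3
        (volume.restrict (parabolicCylinder 1 (0 : ℝ × EuclideanSpace ℝ (Fin 3)))) +
      eLpNorm (uncurry (q k)) (3 / 2)
        (volume.restrict (parabolicCylinder 1 (0 : ℝ × EuclideanSpace ℝ (Fin 3)))))) < ∞)
    {K : Set (ℝ × EuclideanSpace ℝ (Fin 3))} (hKO : K ⊆ parabolicCylinder 1 (0 : ℝ × EuclideanSpace ℝ (Fin 3)))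
    (hlim : Tendsto (fun k => eLpNorm (uncurry (v k) - uncurry u) 3 (volume.restrict K)) atTop (𝓝 0))
    {r₁ : ℝ} (hr₁ : 0 < r₁) {M : ℝ≥0∞} (hMtop : M ≠ ∞) :
    ∃ s C : ℝ, 0 < s ∧ s ≤ r₁ ∧ 0 ≤ C ∧ ∀ᶠ k in atTop, ∀ w' : ℝ × EuclideanSpace ℝ (Fin 3),
      parabolicCylinder r₁ w' ⊆ K →
      (∀ᵐ w ∂(volume.restrict (parabolicCylinder r₁ w')), ‖u w.1 w.2‖ₑ ≤ M) →
      eLpNorm (uncurry (v k)) ∞ (volume.restrict (parabolicCylinder (s / 2) w')) ≤ ENNReal.ofReal (C / s) := by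
  -- the domain `Ω = Q(0, 1)` of the approximants
  set O : Opens (ℝ × EuclideanSpace ℝ (Fin 3)) :=
    parabolicCylinderOpens 1 (0 : ℝ × EuclideanSpace ℝ (Fin 3)) with hOdef
  have hKO' : K ⊆ (O : Set (ℝ × EuclideanSpace ℝ (Fin 3))) := hKO
  -- the constants of the pressure decay estimate and of the criterion
  obtain ⟨c, hPD⟩ := seregin_sverak_pressure_decay_holds.ratio
  obtain ⟨ε₁, C₀, hε₁, hC₀, hReg⟩ := unforced_epsilonRegularity_of_theorem15_3 RRS2016.theorem15_3_holds
  obtain ⟨θ, hθ, hθhalf, hcθ⟩ := exists_ratio_mul_le_half c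
  have hθ1 : θ ≤ 1 := hθhalf.trans (by norm_num)
  -- the uniform `L^{3/2}(Q)` bound of the pressures
  set Bsup : ℝ≥0∞ := ⨆ k, (eLpNorm (uncurry (v k)) 3
      (volume.restrict (parabolicCylinder 1 (0 : ℝ × EuclideanSpace ℝ (Fin 3)))) +
    eLpNorm (uncurry (q k)) (3 / 2)
      (volume.restrict (parabolicCylinder 1 (0 : ℝ × EuclideanSpace ℝ (Fin 3))))) with hBsup
  have hBtop : Bsup ≠ ∞ := hsup.ne
  set Cp : ℝ≥0∞ := Bsup ^ (3 / 2 : ℝ) with hCpdef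
  have hCptop : Cp ≠ ∞ := ENNReal.rpow_ne_top_of_nonneg (by norm_num) hBtop
  have hCp : ∀ k, ∫⁻ w in parabolicCylinder 1 (0 : ℝ × EuclideanSpace ℝ (Fin 3)),
      ‖q k w.1 w.2‖ₑ ^ (3 / 2 : ℝ) ≤ Cp := by
    intro k
    refine lintegral_rpow_threeHalves_le_of_eLpNorm_le (f := uncurry (q k)) ?_
    refine le_trans ?_ (le_iSup (fun k => eLpNorm (uncurry (v k)) 3
      (volume.restrict (parabolicCylinder 1 (0 : ℝ × EuclideanSpace ℝ (Fin 3)))) +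
      eLpNorm (uncurry (q k)) (3 / 2)
      (volume.restrict (parabolicCylinder 1 (0 : ℝ × EuclideanSpace ℝ (Fin 3))))) k)
    exact le_add_self
  -- the strong `L³` convergence on `K`
  have hT : Tendsto (fun k => ∫⁻ w in K, ‖v k w.1 w.2 - u w.1 w.2‖ₑ ^ (3 : ℕ)) atTop (𝓝 0) :=
    tendsto_lintegral_cube_of_tendsto_eLpNorm hlim
  -- constants
  set V₁ : ℝ≥0∞ := volume (ball (0 : EuclideanSpace ℝ (Fin 3)) 1) with hV₁
  have hV₁top : V₁ ≠ ∞ := measure_ball_lt_top.ne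
  set Θ : ℝ≥0∞ := ENNReal.ofReal ((θ⁻¹) ^ 2) with hΘ
  set L : ℝ≥0∞ := 1 + 2 * ((c : ℝ≥0∞) * Θ) with hL
  have hLtop : L ≠ ∞ := ENNReal.add_ne_top.2 ⟨ENNReal.one_ne_top,
    ENNReal.mul_ne_top ENNReal.ofNat_ne_top
      (ENNReal.mul_ne_top ENNReal.coe_ne_top ENNReal.ofReal_ne_top)⟩
  set ε : ℝ≥0∞ := ENNReal.ofReal (ε₁ ^ 3) with hεdef
  have hε4 : 0 < ε / 4 :=
    ENNReal.div_pos (ENNReal.ofReal_pos.2 (by positivity)).ne' ENNReal.ofNat_ne_top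
  -- (A) the radius `r₀ ≤ r₁`: `L · 4 |B₁| M³ r₀³ ≤ ε/4`
  obtain ⟨rA, hrA, hA⟩ := exists_forall_ofReal_pow_three_mul_le (N := L * (4 * (V₁ * M ^ 3)))
    (ENNReal.mul_ne_top hLtop (ENNReal.mul_ne_top ENNReal.ofNat_ne_top
      (ENNReal.mul_ne_top hV₁top (ENNReal.pow_ne_top hMtop)))) hε4
  set r₀ : ℝ := min r₁ rA with hr₀def
  have hr₀ : 0 < r₀ := lt_min hr₁ hrA
  have hr₀r₁ : r₀ ≤ r₁ := min_le_left _ _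
  have hAr₀ : ENNReal.ofReal (r₀ ^ 3) * (L * (4 * (V₁ * M ^ 3))) ≤ ε / 4 :=
    hA r₀ hr₀ (min_le_right _ _)
  -- (B) the number of steps `J`
  set P : ℝ≥0∞ := (ENNReal.ofReal r₀ ^ 2)⁻¹ * Cp with hPdef
  have hPtop : P ≠ ∞ :=
    ENNReal.mul_ne_top (ENNReal.inv_ne_top.2 (pow_ne_zero 2 (ENNReal.ofReal_pos.2 hr₀).ne')) hCptop
  obtain ⟨J, hJ⟩ := exists_inv_two_pow_mul_le hPtop hε4
  -- the final scale `s = θᴶ r₀`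
  set s : ℝ := θ ^ J * r₀ with hsdef
  have hs : 0 < s := by positivity
  have hsr₀ : s ≤ r₀ := mul_le_of_le_one_left hr₀.le (pow_le_one₀ hθ.le hθ1)
  have hscale0 : ∀ j : ℕ, 0 < θ ^ j * r₀ := fun j => by positivity
  have hscale1 : ∀ j : ℕ, θ ^ j * r₀ ≤ r₀ := fun j =>
    mul_le_of_le_one_left hr₀.le (pow_le_one₀ hθ.le hθ1)
  have hscale2 : ∀ j ≤ J, s ≤ θ ^ j * r₀ := fun j hj =>
    mul_le_mul_of_nonneg_right (pow_le_pow_of_le_one hθ.le hθ1 hj) hr₀.le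
  -- large `k`: the `L³` distance on `K` is small
  have hevT : ∀ᶠ k : ℕ in atTop, L * (4 * ((ENNReal.ofReal s ^ 2)⁻¹ *
      ∫⁻ w in K, ‖v k w.1 w.2 - u w.1 w.2‖ₑ ^ (3 : ℕ))) ≤ ε / 4 := by
    have hfin : L * (4 * (ENNReal.ofReal s ^ 2)⁻¹) ≠ ∞ :=
      ENNReal.mul_ne_top hLtop (ENNReal.mul_ne_top ENNReal.ofNat_ne_top
        (ENNReal.inv_ne_top.2 (pow_ne_zero 2 (ENNReal.ofReal_pos.2 hs).ne')))
    have h1 := ENNReal.Tendsto.const_mul hT (Or.inr hfin)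
    rw [mul_zero] at h1
    have h2 : Tendsto (fun k : ℕ => L * (4 * ((ENNReal.ofReal s ^ 2)⁻¹ *
        ∫⁻ w in K, ‖v k w.1 w.2 - u w.1 w.2‖ₑ ^ (3 : ℕ)))) atTop (𝓝 0) := by
      refine h1.congr fun k => ?_
      simp only [mul_assoc]
    exact h2.eventually (ge_mem_nhds hε4)
  refine ⟨s, C₀ * ε₁, hs, hsr₀.trans hr₀r₁, by positivity, ?_⟩
  filter_upwards [hevT] with k hkT w' hSK hM
  -- the cylinder `S = Q(w', r₁)` on which `|u| ≤ M`
  set S : Set (ℝ × EuclideanSpace ℝ (Fin 3)) := parabolicCylinder r₁ w' with hSdef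
  have hSO : S ⊆ (O : Set (ℝ × EuclideanSpace ℝ (Fin 3))) := hSK.trans hKO'
  have hsubS₀ : parabolicCylinder r₀ w' ⊆ S := parabolicCylinder_mono hr₀.le hr₀r₁ w'
  have hsubO₀ : parabolicCylinder r₀ w' ⊆ (O : Set (ℝ × EuclideanSpace ℝ (Fin 3))) := hsubS₀.trans hSO
  have hsubO : parabolicCylinder s w' ⊆ (O : Set (ℝ × EuclideanSpace ℝ (Fin 3))) :=
    (parabolicCylinder_mono hs.le hsr₀ w').trans hsubO₀
  -- the cubic inputs of the approximant `v^{(k)}`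
  set T : ℝ≥0∞ := ∫⁻ w in K, ‖v k w.1 w.2 - u w.1 w.2‖ₑ ^ (3 : ℕ) with hTdef
  set e : ℝ≥0∞ := 4 * (V₁ * M ^ 3 * ENNReal.ofReal (r₀ ^ 3)) +
    4 * ((ENNReal.ofReal s ^ 2)⁻¹ * T) with hedef
  have hCe : ∀ j ≤ J, cknC (θ ^ j * r₀) w' (v k) ≤ e := by
    intro j hj
    have hQS : parabolicCylinder (θ ^ j * r₀) w' ⊆ S :=
      (parabolicCylinder_mono (hscale0 j).le (hscale1 j) w').trans hsubS₀
    have hQK : parabolicCylinder (θ ^ j * r₀) w' ⊆ K := hQS.trans hSK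
    refine (cknC_le_of_ae_bound_of_lintegral_sub (hscale0 j) hQS hQK hM le_rfl).trans ?_
    have h1 : ENNReal.ofReal ((θ ^ j * r₀) ^ 3) ≤ ENNReal.ofReal (r₀ ^ 3) :=
      ENNReal.ofReal_le_ofReal (pow_le_pow_left₀ (hscale0 j).le (hscale1 j) 3)
    have h2 : (ENNReal.ofReal (θ ^ j * r₀) ^ 2)⁻¹ ≤ (ENNReal.ofReal s ^ 2)⁻¹ :=
      ENNReal.inv_le_inv.2 (pow_le_pow_left' (ENNReal.ofReal_le_ofReal (hscale2 j hj)) 2)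
    rw [hedef]
    gcongr
  -- the pressure of the approximant at the last scale
  have hD : cknD s w' (q k) ≤
      (2⁻¹ : ℝ≥0∞) ^ J * cknD r₀ w' (q k) + 2 * ((c : ℝ≥0∞) * Θ * e) :=
    cknD_iterate_le_of_pressure_decay hPD hθ hθ1 hcθ (hball k).1.distributional hr₀
      hsubO₀ (fun j hj => hCe j hj.le)
  have hD0 : cknD r₀ w' (q k) ≤ P :=
    (cknD_le_of_subset (q k) hsubO₀).trans (mul_le_mul_right (hCp k) _)
  -- smallness at the scale `s`
  have hsmall : cknC s w' (v k) + cknD s w' (q k) ≤ ε := by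
    have h1 : cknC s w' (v k) ≤ e := hCe J le_rfl
    have h2 : L * e ≤ ε / 4 + ε / 4 := by
      rw [hedef, mul_add]
      refine add_le_add ?_ hkT
      calc L * (4 * (V₁ * M ^ 3 * ENNReal.ofReal (r₀ ^ 3)))
          = ENNReal.ofReal (r₀ ^ 3) * (L * (4 * (V₁ * M ^ 3))) := by ring
        _ ≤ ε / 4 := hAr₀
    have h3 : (2⁻¹ : ℝ≥0∞) ^ J * cknD r₀ w' (q k) ≤ ε / 4 := le_trans (by gcongr) hJ
    calc cknC s w' (v k) + cknD s w' (q k)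
        ≤ e + ((2⁻¹ : ℝ≥0∞) ^ J * cknD r₀ w' (q k) + 2 * ((c : ℝ≥0∞) * Θ * e)) := add_le_add h1 hD
      _ = L * e + (2⁻¹ : ℝ≥0∞) ^ J * cknD r₀ w' (q k) := by rw [hL]; ring
      _ ≤ (ε / 4 + ε / 4) + ε / 4 := add_le_add h2 h3
      _ ≤ ε := ENNReal.add_quarters_le ε
  -- the quantitative criterion for `(v^{(k)}, q^{(k)})` on `Ω = Q(0, 1)` at the vertex `w'`
  obtain ⟨G, hS⟩ := (hball k).exists_isLRSuitableWeakSolutionOn 3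
  have hum : AEMeasurable
      (fun w : ℝ × EuclideanSpace ℝ (Fin 3) => ‖v k w.1 w.2‖ₑ ^ (3 : ℕ))
      (volume.restrict (parabolicCylinder s w')) :=
    ((hS.distributional.1.aestronglyMeasurable).mono_measure
      (Measure.restrict_mono hsubO le_rfl)).aemeasurable.enorm.pow_const 3
  have hUP := setLIntegral_cubic_add_pressure_le_of_cknC_add_cknD_le hs hum hsmall
  have key := hReg O 3 (v k) (q k) G (by norm_num) hS w' s ε₁ hs hsubO hε₁.le le_rfl hUP
  rw [eLpNorm_exponent_top]
  exact eLpNormEssSup_le_of_ae_bound key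

end Summit.NavierStokesRegularity.NavierStokesRegularity.Theorems.AveragedConeLiouville.QuantPersistence

end
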